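import Mathlib
import Literature.Computability.Complexity.SymmetricCircuit
import Literature.Computability.Complexity.CircuitComposition
import Literature.Computability.Complexity.NegationElimination
import Literature.Computability.Complexity.CircuitRestriction
import Literature.Computability.Complexity.BlockTuples
import Summits.PneNP.PneNP.Theorems.SymmetryBudgetWindowBarrierMonadicLayout
import Summits.PneNP.PneNP.Theorems.SymmetryBudgetWindowBarrierStubHeaderHardwiring
/-!
# Materialisation of monadic guesses for symmetric circuits (generic input sort) — layout
(helper for crux `SymmetryBudget.WindowBarrier`, item stmt-PneNP-2145, line
`canonical-form-completeness`, stub S4 / its pure core (★))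

MATERIALISATION LEMMA, GENERIC FORM — the formal content of "subset-indexed brute force", the
route's and the disprover's reason why CFI-type witnesses die in the window. Inputs: a sort `ι` on
which `Sym(Fin g)` acts (by any `act`), plus `g` point inputs (a guessed subset `S ⊆ Fin g`, entered
as its indicator). For a threshold circuit `C` on `ι ⊕ Fin g` admitting, for every `σ`, an automorphism
over `Sum.map (act σ) σ`, the function `x ↦ op((C(x, 1_S))_S)` — for any `tcBasis` gate `op` over the
`2^g` copy outputs (`∨`: `[∃ S, C(x,1_S)]`; `MAJ` with constant padding: `[t ≤ #{S | C(x,1_S)}]`) — is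
computed by a circuit on `ι` alone with `2^g · |C| + 3` gates admitting, for every `σ`, an automorphism
over `act σ`: two constant gates, one relocated copy of `C` per subset with the point input `u`
hard-wired to `[u ∈ S]`, and the final gate. Because input sort and symmetry format are preserved the
construction COMPOSES (nested guesses, `q`-colourings). This file: subset wirings, the layout
`exists_layout` and its indexing lemmas; symmetry, evaluation, theorems and tests are in
`SymmetryBudgetWindowBarrierMaterialise{Symm,Guess,Tests}.lean`. The `ι`-specific lemmas
`exists_subsetWire`, `gateOK_block`, `gateOK_finalGate`, `exists_layout`, `layout_length`,
`layout_getElem_pre/block/final` of `SymmetryBudgetWindowBarrierMonadicLayout.lean` (namespace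
`Monadic`, `ι = Fin g × Fin g`) are INSTANCES of the ones here — use the `Materialise` versions; the
`ι`-independent lemmas of that file (block arithmetic, block permutation `id₂ ⊕ (π ≀ σ) ⊕ id₁`,
transcript bridges) are re-exported (`export Monadic (…)`), not copied. In the window `g = ⌊log₂ m⌋`
the cost is `poly(m)`: every property of the free part of the form "some vertex subset passes a
symmetric poly-size test" is symmetric-cheap, and every fooling pair for S4/(★) must agree on all of
them. Folklore in the CPT literature (Dawar–Richerby–Rossman 2008; Pakusa–Schalthöfer–Selman 2016:
CFI over logarithmic colour classes is CPT-definable).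
-/
-- `Summit.PneNP.PneNP.…` duplicates `PneNP` BY DESIGN (single-problem summit).
set_option linter.dupNamespace false

namespace Summit.PneNP.PneNP.Theorems

open Literature.Computability.Complexity Literature.Computability.Complexity.GateList
open scoped Classical

namespace Materialise

/-! ### Shared ι-independent lemmas

The block arithmetic, the block permutation `id₂ ⊕ (π ≀ σ) ⊕ id₁` and the two transcript bridges do
not depend on the input sort; they are the ones already landed in
`SymmetryBudgetWindowBarrierMonadicLayout.lean` (namespace `Monadic`), re-exported here. -/

export Monadic (div_lt_of_lt_mul mod_lt_of_lt_mul blockMap_lt blockMap_inv exists_blockPerm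
  wireVal_eq_wireOf vals_eq_transcript)

/-! ### The layout: constants, one relocated copy of `C` per block, a final `∨` -/

variable {ι : Type*} {g : ℕ}

/-- **The subset wirings.** Block `i` (subset `e i`) rewires the matrix input `(u,v)` of the
template to the matrix input `(u,v)` and the point input `u` to the constant gate `0` (value
`true`) if `u ∈ e i`, to the constant gate `1` (value `false`) otherwise. -/
theorem exists_subsetWire (N : ℕ) (e : Fin N → Finset (Fin g)) :
    ∃ φ : Fin N → (ι ⊕ Fin g) → ι ⊕ ℕ,
      (∀ i, WiresOK 2 (φ i)) ∧ (∀ i p, φ i (Sum.inl p) = Sum.inl p) ∧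
      (∀ i u, φ i (Sum.inr u) = Sum.inr (if u ∈ e i then 0 else 1)) := by
  refine ⟨fun i w => Sum.elim (fun p => Sum.inl p) (fun u => Sum.inr (if u ∈ e i then 0 else 1)) w,
    fun i => ?_, fun _ _ => rfl, fun _ _ => rfl⟩
  rintro (p | u) k hk
  · cases hk
  · simp only [Sum.elim_inr, Sum.inr.injEq] at hk
    split_ifs at hk <;> omega

/-- Every relocated block gate only reads earlier positions. -/
theorem gateOK_block (N : ℕ) (C : Circuit (ι ⊕ Fin g))
    (φ : Fin N → (ι ⊕ Fin g) → ι ⊕ ℕ) (hφ : ∀ i, WiresOK 2 (φ i))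
    (v : ℕ) (hv : v < N * C.gates.length) :
    GateOK (2 + v) (reloc (φ ⟨v / C.gates.length, div_lt_of_lt_mul hv⟩)
      (2 + (v / C.gates.length) * C.gates.length)
      (C.gates[v % C.gates.length]'(mod_lt_of_lt_mul hv))) := by
  intro a k hk
  simp only [reloc] at hk
  cases hw : (C.gates[v % C.gates.length]'(mod_lt_of_lt_mul hv)).args a with
  | inl w =>
    rw [hw] at hk
    simp only [shiftWire] at hk
    have := hφ _ w k hk
    omega
  | inr k' =>
    rw [hw] at hk
    simp only [shiftWire, Sum.inr.injEq] at hk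
    have hk' : k' < v % C.gates.length := C.wf _ (mod_lt_of_lt_mul hv) a k' hw
    have := Nat.div_add_mod' v C.gates.length
    omega

/-- **The final gate** of the layout: `N` block-output wires followed by `A` constant wires
(`κ i < 2` selects the constant gate). It only reads earlier positions. -/
theorem gateOK_finalGate (N A : ℕ) (C : Circuit (ι ⊕ Fin g))
    (φ : Fin N → (ι ⊕ Fin g) → ι ⊕ ℕ) (hφ : ∀ i, WiresOK 2 (φ i))
    (op : (Fin (N + A) → Bool) → Bool) (κ : ℕ → ℕ) (hκ : ∀ i, κ i < 2) :
    GateOK (2 + N * C.gates.length)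
      (⟨N + A, op, fun k => if h : (k : ℕ) < N then
          shiftWire (φ ⟨k, h⟩) (2 + (k : ℕ) * C.gates.length) C.output
        else Sum.inr (κ (k - N))⟩ : Gate ι) := by
  intro a k hk
  dsimp only at hk
  by_cases ha : (a : ℕ) < N
  · rw [dif_pos ha] at hk
    cases hw : C.output with
    | inl w =>
      rw [hw] at hk
      simp only [shiftWire] at hk
      have := hφ _ w k hk
      omega
    | inr k' =>
      rw [hw] at hk
      simp only [shiftWire, Sum.inr.injEq] at hk
      have hk' : k' < C.gates.length := C.wf_output k' hw
      have := blockIndex_lt hk' ha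
      omega
  · rw [dif_neg ha] at hk
    simp only [Sum.inr.injEq] at hk
    have := hκ (a - N)
    omega

/-- **The layout exists as a `Circuit`.** Gates: the prefix `pre` (two wireless gates), then for
`v < N·c` the gate `C.gates[v % c]` of block `v / c` relocated behind `2 + (v/c)·c` gates along the
block's wiring, then one `∨_N` gate reading the `N` block outputs; output = that `∨` gate. -/
theorem exists_layout (N A : ℕ) (C : Circuit (ι ⊕ Fin g))
    (pre : List (Gate ι)) (hpreL : pre.length = 2) (hpreWF : WF pre)
    (φ : Fin N → (ι ⊕ Fin g) → ι ⊕ ℕ) (hφ : ∀ i, WiresOK 2 (φ i))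
    (op : (Fin (N + A) → Bool) → Bool) (κ : ℕ → ℕ) (hκ : ∀ i, κ i < 2) :
    ∃ D : Circuit ι,
      D.gates = pre ++
        (List.ofFn fun v : Fin (N * C.gates.length) =>
          reloc (φ ⟨v / C.gates.length, div_lt_of_lt_mul v.2⟩) (2 + (v / C.gates.length) * C.gates.length)
            (C.gates[(v : ℕ) % C.gates.length]'(mod_lt_of_lt_mul v.2))) ++
        [⟨N + A, op, fun k => if h : (k : ℕ) < N then
            shiftWire (φ ⟨k, h⟩) (2 + (k : ℕ) * C.gates.length) C.output
          else Sum.inr (κ (k - N))⟩] ∧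
      D.output = Sum.inr (2 + N * C.gates.length) := by
  have hwf : WF (pre ++
        (List.ofFn fun v : Fin (N * C.gates.length) =>
          reloc (φ ⟨v / C.gates.length, div_lt_of_lt_mul v.2⟩) (2 + (v / C.gates.length) * C.gates.length)
            (C.gates[(v : ℕ) % C.gates.length]'(mod_lt_of_lt_mul v.2))) ++
        [⟨N + A, op, fun k => if h : (k : ℕ) < N then
            shiftWire (φ ⟨k, h⟩) (2 + (k : ℕ) * C.gates.length) C.output
          else Sum.inr (κ (k - N))⟩]) := by
    refine (hpreWF.append ?_).append ?_
    · intro j q hq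
      obtain ⟨hjl, hq'⟩ := List.getElem?_eq_some_iff.1 hq
      rw [List.length_ofFn] at hjl
      rw [List.getElem_ofFn] at hq'
      subst hq'
      rw [hpreL]
      exact gateOK_block N C φ hφ j hjl
    · intro j q hq
      obtain ⟨rfl, rfl⟩ : j = 0 ∧ (⟨N + A, op, fun k => if h : (k : ℕ) < N then
            shiftWire (φ ⟨k, h⟩) (2 + (k : ℕ) * C.gates.length) C.output
          else Sum.inr (κ (k - N))⟩ : Gate ι) = q := by
        simpa [List.getElem?_singleton] using hq
      simp only [List.length_append, List.length_ofFn, hpreL, Nat.add_zero]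
      exact gateOK_finalGate N A C φ hφ op κ hκ
  refine ⟨toCircuit _ (Sum.inr (2 + N * C.gates.length)) hwf (fun k hk => ?_), rfl, rfl⟩
  simp only [Sum.inr.injEq] at hk
  subst hk
  simp [hpreL]


/-! ### Indexing into the layout -/

section Layout

variable {ι : Type*} {g N A : ℕ} {C : Circuit (ι ⊕ Fin g)} {pre : List (Gate ι)}
  {φ : Fin N → (ι ⊕ Fin g) → ι ⊕ ℕ} {D : Circuit ι}
  {op : (Fin (N + A) → Bool) → Bool} {κ : ℕ → ℕ}

/-- Length of the layout. -/
theorem layout_length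
    (hDg : D.gates = pre ++
      (List.ofFn fun v : Fin (N * C.gates.length) =>
        reloc (φ ⟨v / C.gates.length, div_lt_of_lt_mul v.2⟩) (2 + (v / C.gates.length) * C.gates.length)
          (C.gates[(v : ℕ) % C.gates.length]'(mod_lt_of_lt_mul v.2))) ++
      [⟨N + A, op, fun k => if h : (k : ℕ) < N then
          shiftWire (φ ⟨k, h⟩) (2 + (k : ℕ) * C.gates.length) C.output
        else Sum.inr (κ (k - N))⟩]) (hpreL : pre.length = 2) :
    D.gates.length = 2 + N * C.gates.length + 1 := by
  rw [hDg]
  simp only [List.length_append, List.length_ofFn, List.length_singleton, hpreL]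

/-- The prefix gates of the layout. -/
theorem layout_getElem_pre
    (hDg : D.gates = pre ++
      (List.ofFn fun v : Fin (N * C.gates.length) =>
        reloc (φ ⟨v / C.gates.length, div_lt_of_lt_mul v.2⟩) (2 + (v / C.gates.length) * C.gates.length)
          (C.gates[(v : ℕ) % C.gates.length]'(mod_lt_of_lt_mul v.2))) ++
      [⟨N + A, op, fun k => if h : (k : ℕ) < N then
          shiftWire (φ ⟨k, h⟩) (2 + (k : ℕ) * C.gates.length) C.output
        else Sum.inr (κ (k - N))⟩]) (hpreL : pre.length = 2) {v : ℕ} (hv : v < 2)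
    (hv' : v < D.gates.length) : D.gates[v] = pre[v]'(by omega) := by
  simp only [hDg]
  rw [List.getElem_append_left (by simp [hpreL]; omega), List.getElem_append_left]

/-- The block gates of the layout: block `i`, position `j` sits at `2 + i·c + j`. -/
theorem layout_getElem_block
    (hDg : D.gates = pre ++
      (List.ofFn fun v : Fin (N * C.gates.length) =>
        reloc (φ ⟨v / C.gates.length, div_lt_of_lt_mul v.2⟩) (2 + (v / C.gates.length) * C.gates.length)
          (C.gates[(v : ℕ) % C.gates.length]'(mod_lt_of_lt_mul v.2))) ++
      [⟨N + A, op, fun k => if h : (k : ℕ) < N then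
          shiftWire (φ ⟨k, h⟩) (2 + (k : ℕ) * C.gates.length) C.output
        else Sum.inr (κ (k - N))⟩]) (hpreL : pre.length = 2) (i : Fin N)
    (j : Fin C.gates.length) (hv : 2 + (i : ℕ) * C.gates.length + j < D.gates.length) :
    D.gates[2 + (i : ℕ) * C.gates.length + j] =
      reloc (φ i) (2 + (i : ℕ) * C.gates.length) (C.gates[(j : ℕ)]'j.2) := by
  have hij := blockIndex_lt j.2 i.2
  simp only [hDg]
  rw [List.getElem_append_left (by simp [hpreL]; omega), List.getElem_append_right (by omega)]
  simp only [hpreL, List.getElem_ofFn]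
  have e1 : (2 + (i : ℕ) * C.gates.length + (j : ℕ) - 2) = (i : ℕ) * C.gates.length + j := by omega
  have hdm := div_mod_block (k := (i : ℕ)) j.2
  have hfin : (⟨(2 + (i : ℕ) * C.gates.length + (j : ℕ) - 2) / C.gates.length,
      div_lt_of_lt_mul (by omega)⟩ : Fin N) = i := Fin.ext (by simp only [e1, hdm.1])
  have hmod : (2 + (i : ℕ) * C.gates.length + (j : ℕ) - 2) % C.gates.length = j := by rw [e1, hdm.2]
  have hdiv : (2 + (i : ℕ) * C.gates.length + (j : ℕ) - 2) / C.gates.length = i := by rw [e1, hdm.1]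
  rw [hfin]
  simp only [hmod, hdiv]

/-- The final `∨` gate of the layout. -/
theorem layout_getElem_final
    (hDg : D.gates = pre ++
      (List.ofFn fun v : Fin (N * C.gates.length) =>
        reloc (φ ⟨v / C.gates.length, div_lt_of_lt_mul v.2⟩) (2 + (v / C.gates.length) * C.gates.length)
          (C.gates[(v : ℕ) % C.gates.length]'(mod_lt_of_lt_mul v.2))) ++
      [⟨N + A, op, fun k => if h : (k : ℕ) < N then
          shiftWire (φ ⟨k, h⟩) (2 + (k : ℕ) * C.gates.length) C.output
        else Sum.inr (κ (k - N))⟩]) (hpreL : pre.length = 2)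
    (hv : 2 + N * C.gates.length < D.gates.length) :
    D.gates[2 + N * C.gates.length] =
      ⟨N + A, op, fun k => if h : (k : ℕ) < N then
          shiftWire (φ ⟨k, h⟩) (2 + (k : ℕ) * C.gates.length) C.output
        else Sum.inr (κ (k - N))⟩ := by
  simp only [hDg]
  rw [List.getElem_append_right (by simp [hpreL])]
  simp [hpreL]

end Layout


end Materialise

/-- **Registered sub-goal `stub_materialiseSubsetWire`** (crux stmt-PneNP-2145, helper of S4): the
subset wirings of the generic materialisation layout (`Materialise.exists_subsetWire`). -/
theorem stub_materialiseSubsetWire : ∀ (ι : Type) (g N : ℕ) (e : Fin N → Finset (Fin g)), ∃ φ : Fin N → (ι ⊕ Fin g) → ι ⊕ ℕ, (∀ i, WiresOK 2 (φ i)) ∧ (∀ i p, φ i (Sum.inl p) = Sum.inl p) ∧ (∀ i u, φ i (Sum.inr u) = Sum.inr (if u ∈ e i then 0 else 1)) :=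
  fun _ _ N e => Materialise.exists_subsetWire N e

end Summit.PneNP.PneNP.Theorems
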